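import Literature.MathematicalPhysics.QuantumFieldTheory.Balaban1983to89.Node00.CriticalOnFibreTopFloor

/-!
# NODE 00 — GUARD-GENERIC twins of the stub-1 chain's named facts: `Prop8RegSepTopStepG`, `HalvingStepTopG`, `HalvingStepTopCoreG` — the same sentences asked only of the
# prefix data `(ν, M, g, K, k, s)` satisfying an ARBITRARY admissibility predicate `Adm : StepGuard F`; module 46's floor editions are the instance `Adm := floorGuard F c`
# (`Iff.rfl`), module 20∕30's floor-free facts the instance `Adm := ⊤`; every composition of the chain is POINTWISE in the prefix, so any guard threads for free

Cell `pub-ymgap` (HUMAN RULINGS D-0062 ∕ D-0088), seat `pub-ymgap-dag-n07-e` g20 (R141 (C) row s3 lineage; DAG node N07 = [B11]; lane owner; declarer of modules 20∕23∕29∕30∕34c∕36c∕46), 2026-08-28.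
`--kind definition --supports stmt-QuantumFields-20541` (K0⁷; count-neutral).  Sequel of module 46 `Node00/CriticalOnFibreTopFloor` (p620435); the second half of the repair of
LOCATED-STUB1-FLOOR (this seat, cell bus 2026-08-28 08:50Z) and of the head's LOCATED-UNGUARDED-LEVELS (dag-n07-w4, cell bus 2026-08-28 08:05Z).

THE PRINT.  [B11] = T. Bałaban, CMP **102** (1985) 277–309 `[Balaban1985Variational]`: Prop. 8 p. 304 is stated for the numerics OF THE CONSTRUCTION — p. 304 lines 1–2 *«We may
assume that R₁M₁ is sufficiently big, so that (163)»* (a floor on the big-block numerics, never discharged below it because [III] = CMP **119** (1988) `[Balaban1988Convergent]` §2 fixes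
`M₁, R₁` once), p. 303 last line *«B₃ depends on d and L only»*; and for steps `k` of an actual run on the torus `T_η`, `η = L^{-(m+K)}·(2L^m)`-periodic ([I] = CMP **109** (1987)
`[Balaban1987RG1]` (0.1) p. 251), where the windows of Sect. F (cubes of size `2R₁M₁L^jη`, (144) p. 300) do not wrap.  The tree's floor-free facts `Prop8RegSepTopStep` (module 20),
`HalvingStepTop` (module 30), `HalvingStepTopCore` (k0-s1-w3) ask the sentence of EVERY prefix `(ν, M, g, K, k, s)` with `0 < ν.M₁`, `1 ≤ k` — in particular of numerics below print's
floor (LOCATED-STUB1-FLOOR) and of levels `k` at which the datum windows wrap around `F.P K` (LOCATED-UNGUARDED-LEVELS: the constant sequence `Ω ≡ T` is a legal index at every `k`).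
Module 46 inserted the ONE binder `c ≤ ν.M₁`.  Which further guard (if any) the K0 skeleton's stub-1 text should carry is the plan's word (V20); THIS FILE makes every such wording an
INSTANTIATION: the binder is an arbitrary predicate `Adm ν M g K k s` on the prefix, inserted at the same place (right after `0 < ν.M₁`).

WHAT IS PROVED (sorry-free; FIVE definitions — the guard type `StepGuard`, the floor guard `floorGuard`, and three named facts (`Prop`s, never asserted); axioms standard).
* §0 `StepGuard F` (the type of prefix predicates), `floorGuard F c := fun ν _ _ _ _ _ => c ≤ ν.M₁`.
* §1 `Prop8RegSepTopStepG ∕ HalvingStepTopG ∕ HalvingStepTopCoreG F N Sup Adm B₃ a₀ a₁`; for each: `.toG` (floor-free ⇒ every guard), `.of_le` (antitone in `a₀ a₁`), `.of_imp`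
  (ANTITONE in the guard: `Adm′ ⇒ Adm` pointwise gives `G Adm → G Adm′`), `…G_top_iff` (`Adm := ⊤` is the floor-free fact), `…R_iff_G_floorGuard` (module 46's floor edition IS the
  instance `floorGuard F c`, `Iff.rfl`), `….toG_of_imp_floor` (a floor-carrying fact serves every guard implying its floor), `….toR_of_floor_imp` (converse), for `Prop8RegSepTopStepG`
  also `.and_right ∕ .and_left` (conjunctions of guards); ★ `halvingStepTopCoreG_of_halvingStepTopG`.
* §2 ★ `classTop_iterate_of_halvingStepTopG`, ★★ `prop8RegSepTopStepG_of_halvingStepTopG` (`0 < B₃`), ★ `halvingStepTopG_of_prop8RegSepTopStepG`, ★★ `halvingStepTopG_iff_prop8RegSepTopStepG`,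
  `prop8RegSepTopStepG_of_coreG_of_link` (the chain in one line, the guarded Core ⇒ Top link as a hypothesis) — module 30 §2–§4 ∕ module 46 §4 with `(hadm : Adm ν M g K k s)`
  threaded; the proofs are the same terms.
NOT HERE: any particular level guard (the head's `k + c₀ ≤ F.m + K` ∕ non-wrapping letter is the plan's to word), the guarded Core ⇒ Top direction (k0-s1-w3's pen), the guarded
local-letters tokens (n07-w4's pen, INTENT-7 files the floor instances), the K0 skeleton text (plan, V20).
HONEST SCOPE.  Definitions of named facts + binder-threading bookkeeping; nothing of [B11]'s analysis asserted or proved; no floor-free or floor-carrying fact is claimed false;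
`stub_prop8StepCoP13` ∕ K0⁷ NOT closed; N07 NOT discharged; counts unmoved (28∕28 · 5∕27); one finite 𝕋⁴ programme at fixed ε — the route closes the conditional finite-𝕋⁴ rung
`BalabanLadder.UV` only; nothing continuum ∕ ℝ⁴ ∕ OS ∕ mass gap ∕ Clay.  No `sorry`, no `instance`, no `notation`.

References: [B11] (144) p.300, (161)–(163) p.303, (166) p.304, Prop. 8 p.304; [6] = CMP **99** (1985) `[Balaban1985RegularSpaces]` (1.3)–(1.9) p.77; [I] (0.1) p.251, §1 pp.255–264;
[III] (2.6)–(2.8) pp.255–256, (2.12) p.256.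
-/

noncomputable section

namespace Literature.MathematicalPhysics.QuantumFieldTheory.Balaban1983to89.Node00

open scoped Matrix.Norms.L2Operator
open T4Continuum (T4Family)
open B15DeterminingSets

/-- `η_n ≥ 0` on the lattices of record. [cite: Balaban1987RG1, (1.1) p.260 (bookkeeping)] -/
private theorem eta_nonneg_g (P : Params) (n : ℕ) : 0 ≤ P.eta n := by
  unfold Params.eta
  exact pow_nonneg (inv_nonneg.mpr (Nat.cast_nonneg _)) n

/-- Weakening the threshold of the record's `PlaqSmallOn`. [cite: Balaban1988Convergent, (1.4) p.247 (bookkeeping)] -/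
private theorem plaqSmallOn_of_le_g {P : Params} {j : ℕ} {G : Type*} [GaugeGroup G] {S : Set (Plaq P j)} {δ δ' : ℝ} {U : GaugeField P j G}
    (h : PlaqSmallOn S δ U) (hδ : δ ≤ δ') : PlaqSmallOn S δ' U :=
  fun p hp => (h p hp).trans_le hδ

/-- `max{B₃δ, c} ≤ 2·max{B₃δ′, c}` from `δ ≤ 2δ′` (`B₃, c ≥ 0`). [cite: Balaban1985Variational, p.304 before Prop. 8 (bookkeeping)] -/
private theorem max_le_two_mul_max_g {B₃ c d d' : ℝ} (hB₃ : 0 ≤ B₃) (hc : 0 ≤ c) (hd : d ≤ 2 * d') :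
    max (B₃ * d) c ≤ 2 * max (B₃ * d') c := by
  refine max_le ?_ ?_
  · calc B₃ * d ≤ B₃ * (2 * d') := mul_le_mul_of_nonneg_left hd hB₃
      _ = 2 * (B₃ * d') := by ring
      _ ≤ 2 * max (B₃ * d') c := mul_le_mul_of_nonneg_left (le_max_left _ _) zero_le_two
  · calc c ≤ 2 * c := le_mul_of_one_le_left hc one_le_two
      _ ≤ 2 * max (B₃ * d') c := mul_le_mul_of_nonneg_left (le_max_right _ _) zero_le_two

/-! ## §0  The guard type and the floor guard -/

section Guards

variable (F : T4Family)

/-- **THE TYPE OF PREFIX GUARDS**: predicates on the data `(ν, M, g, K, k, s)` quantified by the stub-1 chain's facts BEFORE the thresholds — numerics `ν`, the d-cube input `M`,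
the running couplings `g`, the torus∕step exponents `K, k`, and the (2.18) index `s`.  Print states Prop. 8 for the numerics and steps of the construction only; a guard is how the
tree says «of the construction». [cite: Balaban1985Variational, Prop. 8 p.304, p.304 lines 1–2; Balaban1987RG1, (0.1) p.251] -/
abbrev StepGuard : Type :=
  (ν : Stage7Numerics) → (M : ℕ) → (g : ℕ → ℝ) → (K k : ℕ) → SeqOfRecord F ν M g K k → Prop

/-- **THE FLOOR GUARD** `c ≤ ν.M₁` (module 46's binder): print's «M₁ … R a big positive integer which will be fixed later». [cite: Balaban1985RegularSpaces, (1.3)–(1.6) p.77;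
Balaban1985Variational, p.304 lines 1–2] -/
def floorGuard (c : ℕ) : StepGuard F := fun ν _ _ _ _ _ => c ≤ ν.M₁

variable {F}

/-- The floor guard unfolds to `c ≤ ν.M₁`. [cite: Balaban1985RegularSpaces, (1.3)–(1.6) p.77 (bookkeeping)] -/
@[simp] theorem floorGuard_apply (c : ℕ) (ν : Stage7Numerics) (M : ℕ) (g : ℕ → ℝ) (K k : ℕ) (s : SeqOfRecord F ν M g K k) :
    floorGuard F c ν M g K k s ↔ c ≤ ν.M₁ := Iff.rfl

/-- The floor guard is antitone in the floor: a larger floor is a stronger guard. [cite: Balaban1985RegularSpaces, (1.3)–(1.6) p.77 (bookkeeping)] -/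
theorem floorGuard_imp_of_le {c c' : ℕ} (hcc : c ≤ c') (ν : Stage7Numerics) (M : ℕ) (g : ℕ → ℝ) (K k : ℕ) (s : SeqOfRecord F ν M g K k) :
    floorGuard F c' ν M g K k s → floorGuard F c ν M g K k s := fun h => hcc.trans h

/-- The floor guard at `0` is no guard. [cite: Balaban1985RegularSpaces, (1.3)–(1.6) p.77 (bookkeeping)] -/
theorem floorGuard_zero (ν : Stage7Numerics) (M : ℕ) (g : ℕ → ℝ) (K k : ℕ) (s : SeqOfRecord F ν M g K k) : floorGuard F 0 ν M g K k s :=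
  Nat.zero_le _

end Guards

/-! ## §1  The guard-generic facts -/

section FactsG

variable (F : T4Family) (N : ℕ) [NeZero N]

/-- **[B11] PROPOSITION 8's TOP STEP, GUARD-GENERIC**: module 20's `Prop8RegSepTopStep` with ONE more binder `Adm ν M g K k s` after `0 < ν.M₁` (print: «of the construction»).
[cite: Balaban1985Variational, Prop. 8 p.304; Balaban1985RegularSpaces, (1.3)–(1.6) p.77; Balaban1987RG1, (0.1) p.251] -/
def Prop8RegSepTopStepG (Sup : (ν : Stage7Numerics) → (K : ℕ) → (ℕ → Set (Site (F.P K) 0)) → Set (Site (F.P K) 0)) (Adm : StepGuard F) (B₃ a₀ a₁ : ℝ) : Prop :=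
  ∀ (ν : Stage7Numerics) (M : ℕ) (g : ℕ → ℝ) (K k : ℕ) (s : SeqOfRecord F ν M g K k), Sect2.SeqSeparated ν.M₁ s → 0 < ν.M₁ → Adm ν M g K k s → 1 ≤ k →
    ∀ (ε₀ : ℝ) (δ : ℕ → ℝ),
    (∀ n, n ≤ k → 0 < δ n ∧ δ n ≤ a₁ ∧ B₃ * δ n ≤ ε₀) → (∀ n, n < k → δ n ≤ 2 * δ (n + 1)) → (∀ n, n < k → δ (n + 1) ≤ 2 * δ n) → ε₀ ≤ a₀ →
    ∀ W : MSField (F.P K) (SU N), Sect2.DataSmall7PTop (avOfRecord F N K) s.Ω (Sup ν K s.Ω) k δ W →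
      ∀ U : GaugeField (F.P K) 0 (SU N),
        (∀ n, n ≤ k → PlaqSmallOn (Sect2.omegaPlaqsTop s.Ω (Sup ν K s.Ω) n) (ε₀ * (F.P K).eta n ^ 2) U) →
        Sect2.CoDivClassOnTop s.Ω (Sup ν K s.Ω) k ε₀ U → AgreeOn (genSet s.Ω k) (avgFamily (avOfRecord F N K) U) W →
        IsCritOnFibre F N K (genSet s.Ω k) W U →
        (∀ n, n ≤ k → PlaqSmallOn (Sect2.omegaPlaqsTop s.Ω (Sup ν K s.Ω) n) (B₃ * δ n * (F.P K).eta n ^ 2) U) ∧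
          ∀ n, n ≤ k → Sect2.CoDivSmallOn (Sect2.omegaBondsTop s.Ω (Sup ν K s.Ω) n) (B₃ * δ n * (F.P K).eta n ^ 3) U

/-- **SECT. F's ONE-STEP IMPROVEMENT, GUARD-GENERIC**: module 30's `HalvingStepTop` with the binder `Adm ν M g K k s`. [cite: Balaban1985Variational, Sect. F p.304; Balaban1987RG1, (0.1) p.251] -/
def HalvingStepTopG (Sup : (ν : Stage7Numerics) → (K : ℕ) → (ℕ → Set (Site (F.P K) 0)) → Set (Site (F.P K) 0)) (Adm : StepGuard F) (B₃ a₀ a₁ : ℝ) : Prop :=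
  ∀ (ν : Stage7Numerics) (M : ℕ) (g : ℕ → ℝ) (K k : ℕ) (s : SeqOfRecord F ν M g K k), Sect2.SeqSeparated ν.M₁ s → 0 < ν.M₁ → Adm ν M g K k s → 1 ≤ k →
    ∀ (ε δ : ℕ → ℝ),
    (∀ n, n ≤ k → 0 < δ n ∧ δ n ≤ a₁) → (∀ n, n < k → δ n ≤ 2 * δ (n + 1)) → (∀ n, n < k → δ (n + 1) ≤ 2 * δ n) →
    (∀ n, n ≤ k → B₃ * δ n ≤ ε n ∧ ε n ≤ a₀) → (∀ n, n < k → ε n ≤ 2 * ε (n + 1)) → (∀ n, n < k → ε (n + 1) ≤ 2 * ε n) →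
    ∀ W : MSField (F.P K) (SU N), Sect2.DataSmall7PTop (avOfRecord F N K) s.Ω (Sup ν K s.Ω) k δ W →
      ∀ U : GaugeField (F.P K) 0 (SU N),
        (∀ n, n ≤ k → PlaqSmallOn (Sect2.omegaPlaqsTop s.Ω (Sup ν K s.Ω) n) (ε n * (F.P K).eta n ^ 2) U) →
        (∀ n, n ≤ k → Sect2.CoDivSmallOn (Sect2.omegaBondsTop s.Ω (Sup ν K s.Ω) n) (ε n * (F.P K).eta n ^ 3) U) →
        AgreeOn (genSet s.Ω k) (avgFamily (avOfRecord F N K) U) W →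
        IsCritOnFibre F N K (genSet s.Ω k) W U →
        (∀ n, n ≤ k → PlaqSmallOn (Sect2.omegaPlaqsTop s.Ω (Sup ν K s.Ω) n) (max (B₃ * δ n) (ε n / 2) * (F.P K).eta n ^ 2) U) ∧
          ∀ n, n ≤ k → Sect2.CoDivSmallOn (Sect2.omegaBondsTop s.Ω (Sup ν K s.Ω) n) (max (B₃ * δ n) (ε n / 2) * (F.P K).eta n ^ 3) U

/-- **THE CORE FORM, GUARD-GENERIC**: k0-s1-w3's `HalvingStepTopCore` with the binder `Adm ν M g K k s`. [cite: Balaban1985Variational, Sect. F p.304; Balaban1987RG1, (0.1) p.251] -/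
def HalvingStepTopCoreG (Sup : (ν : Stage7Numerics) → (K : ℕ) → (ℕ → Set (Site (F.P K) 0)) → Set (Site (F.P K) 0)) (Adm : StepGuard F) (B₃ a₀ a₁ : ℝ) : Prop :=
  ∀ (ν : Stage7Numerics) (M : ℕ) (g : ℕ → ℝ) (K k : ℕ) (s : SeqOfRecord F ν M g K k), Sect2.SeqSeparated ν.M₁ s → 0 < ν.M₁ → Adm ν M g K k s → 1 ≤ k →
    ∀ (ε δ : ℕ → ℝ),
    (∀ n, n ≤ k → 0 < δ n ∧ δ n ≤ a₁) → (∀ n, n < k → δ n ≤ 2 * δ (n + 1)) → (∀ n, n < k → δ (n + 1) ≤ 2 * δ n) →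
    (∀ n, n ≤ k → B₃ * δ n ≤ ε n ∧ ε n ≤ a₀) → (∀ n, n < k → ε n ≤ 2 * ε (n + 1)) → (∀ n, n < k → ε (n + 1) ≤ 2 * ε n) →
    ∀ W : MSField (F.P K) (SU N), Sect2.DataSmall7PTop (avOfRecord F N K) s.Ω (Sup ν K s.Ω) k δ W →
      ∀ U : GaugeField (F.P K) 0 (SU N),
        (∀ n, n ≤ k → PlaqSmallOn (Sect2.omegaPlaqsTop s.Ω (Sup ν K s.Ω) n) (ε n * (F.P K).eta n ^ 2) U) →
        (∀ n, n ≤ k → Sect2.CoDivSmallOn (Sect2.omegaBondsTop s.Ω (Sup ν K s.Ω) n) (ε n * (F.P K).eta n ^ 3) U) →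
        AgreeOn (genSet s.Ω k) (avgFamily (avOfRecord F N K) U) W →
        IsCritOnFibre F N K (genSet s.Ω k) W U →
        (∀ n, n ≤ k → ∀ p ∈ Sect2.omegaPlaqsTop s.Ω (Sup ν K s.Ω) n, p ∉ Sect2.printedPlaqs s.Ω k 0 →
            dist1 (GaugeField.plaqHol U p) < max (B₃ * δ n) (ε n / 2) * (F.P K).eta n ^ 2) ∧
          ∀ n, n ≤ k → ∀ b ∈ Sect2.omegaBondsTop s.Ω (Sup ν K s.Ω) n, b ∉ Sect2.bondsDeep (s.Ω 1)ᶜ →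
            ‖Sect2.coDivSum U b.src b.dir‖ < max (B₃ * δ n) (ε n / 2) * (F.P K).eta n ^ 3

variable {F N}

/-! ### `Prop8RegSepTopStepG`: API -/

/-- Floor-free ⇒ guarded, every guard. [cite: Balaban1985Variational, Prop. 8 p.304 (bookkeeping)] -/
theorem Prop8RegSepTopStep.toG {Sup : (ν : Stage7Numerics) → (K : ℕ) → (ℕ → Set (Site (F.P K) 0)) → Set (Site (F.P K) 0)} {B₃ a₀ a₁ : ℝ}
    (h : Prop8RegSepTopStep F N Sup B₃ a₀ a₁) (Adm : StepGuard F) : Prop8RegSepTopStepG F N Sup Adm B₃ a₀ a₁ :=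
  fun ν M g K k s hsep hM₁ _ hk => h ν M g K k s hsep hM₁ hk

/-- Antitone in the ceilings. [cite: Balaban1985Variational, Prop. 8 p.304 (bookkeeping)] -/
theorem Prop8RegSepTopStepG.of_le {Sup : (ν : Stage7Numerics) → (K : ℕ) → (ℕ → Set (Site (F.P K) 0)) → Set (Site (F.P K) 0)} {Adm : StepGuard F} {B₃ a₀ a₀' a₁ a₁' : ℝ}
    (h : Prop8RegSepTopStepG F N Sup Adm B₃ a₀ a₁) (ha₀ : a₀' ≤ a₀) (ha₁ : a₁' ≤ a₁) : Prop8RegSepTopStepG F N Sup Adm B₃ a₀' a₁' :=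
  fun ν M g K k s hsep hM₁ hadm hk ε₀ δ hδ hcomp hcomp' hε₀ W h7 U h17 h19 hfib hcrit =>
    h ν M g K k s hsep hM₁ hadm hk ε₀ δ (fun n hn => ⟨(hδ n hn).1, (hδ n hn).2.1.trans ha₁, (hδ n hn).2.2⟩) hcomp hcomp' (hε₀.trans ha₀) W h7 U h17 h19 hfib hcrit

/-- ANTITONE IN THE GUARD: a stronger guard `Adm′ ⇒ Adm` asks the sentence of fewer prefixes. [cite: Balaban1985Variational, Prop. 8 p.304 (bookkeeping)] -/
theorem Prop8RegSepTopStepG.of_imp {Sup : (ν : Stage7Numerics) → (K : ℕ) → (ℕ → Set (Site (F.P K) 0)) → Set (Site (F.P K) 0)} {Adm Adm' : StepGuard F} {B₃ a₀ a₁ : ℝ}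
    (h : Prop8RegSepTopStepG F N Sup Adm B₃ a₀ a₁) (himp : ∀ ν M g K k s, Adm' ν M g K k s → Adm ν M g K k s) : Prop8RegSepTopStepG F N Sup Adm' B₃ a₀ a₁ :=
  fun ν M g K k s hsep hM₁ hadm' hk => h ν M g K k s hsep hM₁ (himp ν M g K k s hadm') hk

/-- With the trivial guard the guarded fact IS the floor-free one. [cite: Balaban1985Variational, Prop. 8 p.304 (bookkeeping)] -/
theorem prop8RegSepTopStepG_top_iff {Sup : (ν : Stage7Numerics) → (K : ℕ) → (ℕ → Set (Site (F.P K) 0)) → Set (Site (F.P K) 0)} {B₃ a₀ a₁ : ℝ} :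
    Prop8RegSepTopStepG F N Sup (fun _ _ _ _ _ _ => True) B₃ a₀ a₁ ↔ Prop8RegSepTopStep F N Sup B₃ a₀ a₁ :=
  ⟨fun h ν M g K k s hsep hM₁ hk => h ν M g K k s hsep hM₁ trivial hk, fun h => h.toG _⟩

/-- Module 46's floor edition IS the instance `Adm := floorGuard F c`. [cite: Balaban1985RegularSpaces, (1.3)–(1.6) p.77 (bookkeeping)] -/
theorem prop8RegSepTopStepR_iff_G_floorGuard {Sup : (ν : Stage7Numerics) → (K : ℕ) → (ℕ → Set (Site (F.P K) 0)) → Set (Site (F.P K) 0)} {c : ℕ} {B₃ a₀ a₁ : ℝ} :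
    Prop8RegSepTopStepR F N Sup c B₃ a₀ a₁ ↔ Prop8RegSepTopStepG F N Sup (floorGuard F c) B₃ a₀ a₁ :=
  Iff.rfl

/-- A floor-carrying fact serves EVERY guard implying its floor. [cite: Balaban1985RegularSpaces, (1.3)–(1.6) p.77 (bookkeeping)] -/
theorem Prop8RegSepTopStepR.toG_of_imp_floor {Sup : (ν : Stage7Numerics) → (K : ℕ) → (ℕ → Set (Site (F.P K) 0)) → Set (Site (F.P K) 0)} {c : ℕ} {Adm : StepGuard F}
    {B₃ a₀ a₁ : ℝ} (h : Prop8RegSepTopStepR F N Sup c B₃ a₀ a₁) (himp : ∀ ν M g K k s, Adm ν M g K k s → c ≤ ν.M₁) :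
    Prop8RegSepTopStepG F N Sup Adm B₃ a₀ a₁ :=
  (prop8RegSepTopStepR_iff_G_floorGuard.1 h).of_imp himp

/-- Conversely a guarded fact whose guard FOLLOWS from a floor is floor-carrying at that floor. [cite: Balaban1985RegularSpaces, (1.3)–(1.6) p.77 (bookkeeping)] -/
theorem Prop8RegSepTopStepG.toR_of_floor_imp {Sup : (ν : Stage7Numerics) → (K : ℕ) → (ℕ → Set (Site (F.P K) 0)) → Set (Site (F.P K) 0)} {c : ℕ} {Adm : StepGuard F}
    {B₃ a₀ a₁ : ℝ} (h : Prop8RegSepTopStepG F N Sup Adm B₃ a₀ a₁) (himp : ∀ ν M g K k s, c ≤ ν.M₁ → Adm ν M g K k s) :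
    Prop8RegSepTopStepR F N Sup c B₃ a₀ a₁ :=
  prop8RegSepTopStepR_iff_G_floorGuard.2 (h.of_imp himp)

/-- Guards compose by conjunction: a fact guarded by `Adm₁` serves the guard `Adm₁ ∧ Adm₂` (and symmetrically). [cite: Balaban1985Variational, Prop. 8 p.304 (bookkeeping)] -/
theorem Prop8RegSepTopStepG.and_right {Sup : (ν : Stage7Numerics) → (K : ℕ) → (ℕ → Set (Site (F.P K) 0)) → Set (Site (F.P K) 0)} {Adm₁ Adm₂ : StepGuard F} {B₃ a₀ a₁ : ℝ}
    (h : Prop8RegSepTopStepG F N Sup Adm₁ B₃ a₀ a₁) : Prop8RegSepTopStepG F N Sup (fun ν M g K k s => Adm₁ ν M g K k s ∧ Adm₂ ν M g K k s) B₃ a₀ a₁ :=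
  h.of_imp fun _ _ _ _ _ _ h' => h'.1

/-- Guards compose by conjunction (left factor added). [cite: Balaban1985Variational, Prop. 8 p.304 (bookkeeping)] -/
theorem Prop8RegSepTopStepG.and_left {Sup : (ν : Stage7Numerics) → (K : ℕ) → (ℕ → Set (Site (F.P K) 0)) → Set (Site (F.P K) 0)} {Adm₁ Adm₂ : StepGuard F} {B₃ a₀ a₁ : ℝ}
    (h : Prop8RegSepTopStepG F N Sup Adm₂ B₃ a₀ a₁) : Prop8RegSepTopStepG F N Sup (fun ν M g K k s => Adm₁ ν M g K k s ∧ Adm₂ ν M g K k s) B₃ a₀ a₁ :=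
  h.of_imp fun _ _ _ _ _ _ h' => h'.2

/-! ### `HalvingStepTopG`: API -/

/-- Floor-free ⇒ guarded (one step). [cite: Balaban1985Variational, Sect. F p.304 (bookkeeping)] -/
theorem HalvingStepTop.toG {Sup : (ν : Stage7Numerics) → (K : ℕ) → (ℕ → Set (Site (F.P K) 0)) → Set (Site (F.P K) 0)} {B₃ a₀ a₁ : ℝ}
    (h : HalvingStepTop F N Sup B₃ a₀ a₁) (Adm : StepGuard F) : HalvingStepTopG F N Sup Adm B₃ a₀ a₁ :=
  fun ν M g K k s hsep hM₁ _ hk => h ν M g K k s hsep hM₁ hk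

/-- Antitone in the ceilings (one step). [cite: Balaban1985Variational, Sect. F p.304 (bookkeeping)] -/
theorem HalvingStepTopG.of_le {Sup : (ν : Stage7Numerics) → (K : ℕ) → (ℕ → Set (Site (F.P K) 0)) → Set (Site (F.P K) 0)} {Adm : StepGuard F} {B₃ a₀ a₀' a₁ a₁' : ℝ}
    (h : HalvingStepTopG F N Sup Adm B₃ a₀ a₁) (ha₀ : a₀' ≤ a₀) (ha₁ : a₁' ≤ a₁) : HalvingStepTopG F N Sup Adm B₃ a₀' a₁' :=
  fun ν M g K k s hsep hM₁ hadm hk ε δ hδ hcomp hcomp' hε hεcomp hεcomp' W h7 U h17 h19 hfib hcrit =>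
    h ν M g K k s hsep hM₁ hadm hk ε δ (fun n hn => ⟨(hδ n hn).1, (hδ n hn).2.trans ha₁⟩) hcomp hcomp'
      (fun n hn => ⟨(hε n hn).1, (hε n hn).2.trans ha₀⟩) hεcomp hεcomp' W h7 U h17 h19 hfib hcrit

/-- Antitone in the guard (one step). [cite: Balaban1985Variational, Sect. F p.304 (bookkeeping)] -/
theorem HalvingStepTopG.of_imp {Sup : (ν : Stage7Numerics) → (K : ℕ) → (ℕ → Set (Site (F.P K) 0)) → Set (Site (F.P K) 0)} {Adm Adm' : StepGuard F} {B₃ a₀ a₁ : ℝ}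
    (h : HalvingStepTopG F N Sup Adm B₃ a₀ a₁) (himp : ∀ ν M g K k s, Adm' ν M g K k s → Adm ν M g K k s) : HalvingStepTopG F N Sup Adm' B₃ a₀ a₁ :=
  fun ν M g K k s hsep hM₁ hadm' hk => h ν M g K k s hsep hM₁ (himp ν M g K k s hadm') hk

/-- With the trivial guard the guarded one-step fact IS the floor-free one. [cite: Balaban1985Variational, Sect. F p.304 (bookkeeping)] -/
theorem halvingStepTopG_top_iff {Sup : (ν : Stage7Numerics) → (K : ℕ) → (ℕ → Set (Site (F.P K) 0)) → Set (Site (F.P K) 0)} {B₃ a₀ a₁ : ℝ} :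
    HalvingStepTopG F N Sup (fun _ _ _ _ _ _ => True) B₃ a₀ a₁ ↔ HalvingStepTop F N Sup B₃ a₀ a₁ :=
  ⟨fun h ν M g K k s hsep hM₁ hk => h ν M g K k s hsep hM₁ trivial hk, fun h => h.toG _⟩

/-- Module 46's floor edition IS the instance `Adm := floorGuard F c` (one step). [cite: Balaban1985RegularSpaces, (1.3)–(1.6) p.77 (bookkeeping)] -/
theorem halvingStepTopR_iff_G_floorGuard {Sup : (ν : Stage7Numerics) → (K : ℕ) → (ℕ → Set (Site (F.P K) 0)) → Set (Site (F.P K) 0)} {c : ℕ} {B₃ a₀ a₁ : ℝ} :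
    HalvingStepTopR F N Sup c B₃ a₀ a₁ ↔ HalvingStepTopG F N Sup (floorGuard F c) B₃ a₀ a₁ :=
  Iff.rfl

/-- A floor-carrying one-step fact serves every guard implying its floor. [cite: Balaban1985RegularSpaces, (1.3)–(1.6) p.77 (bookkeeping)] -/
theorem HalvingStepTopR.toG_of_imp_floor {Sup : (ν : Stage7Numerics) → (K : ℕ) → (ℕ → Set (Site (F.P K) 0)) → Set (Site (F.P K) 0)} {c : ℕ} {Adm : StepGuard F}
    {B₃ a₀ a₁ : ℝ} (h : HalvingStepTopR F N Sup c B₃ a₀ a₁) (himp : ∀ ν M g K k s, Adm ν M g K k s → c ≤ ν.M₁) :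
    HalvingStepTopG F N Sup Adm B₃ a₀ a₁ :=
  (halvingStepTopR_iff_G_floorGuard.1 h).of_imp himp

/-- A guarded one-step fact whose guard follows from a floor is floor-carrying. [cite: Balaban1985RegularSpaces, (1.3)–(1.6) p.77 (bookkeeping)] -/
theorem HalvingStepTopG.toR_of_floor_imp {Sup : (ν : Stage7Numerics) → (K : ℕ) → (ℕ → Set (Site (F.P K) 0)) → Set (Site (F.P K) 0)} {c : ℕ} {Adm : StepGuard F}
    {B₃ a₀ a₁ : ℝ} (h : HalvingStepTopG F N Sup Adm B₃ a₀ a₁) (himp : ∀ ν M g K k s, c ≤ ν.M₁ → Adm ν M g K k s) :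
    HalvingStepTopR F N Sup c B₃ a₀ a₁ :=
  halvingStepTopR_iff_G_floorGuard.2 (h.of_imp himp)

/-! ### `HalvingStepTopCoreG`: API -/

/-- Floor-free ⇒ guarded (core form). [cite: Balaban1985Variational, Sect. F p.304 (bookkeeping)] -/
theorem HalvingStepTopCore.toG {Sup : (ν : Stage7Numerics) → (K : ℕ) → (ℕ → Set (Site (F.P K) 0)) → Set (Site (F.P K) 0)} {B₃ a₀ a₁ : ℝ}
    (h : HalvingStepTopCore F N Sup B₃ a₀ a₁) (Adm : StepGuard F) : HalvingStepTopCoreG F N Sup Adm B₃ a₀ a₁ :=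
  fun ν M g K k s hsep hM₁ _ hk => h ν M g K k s hsep hM₁ hk

/-- Antitone in the ceilings (core form). [cite: Balaban1985Variational, Sect. F p.304 (bookkeeping)] -/
theorem HalvingStepTopCoreG.of_le {Sup : (ν : Stage7Numerics) → (K : ℕ) → (ℕ → Set (Site (F.P K) 0)) → Set (Site (F.P K) 0)} {Adm : StepGuard F} {B₃ a₀ a₀' a₁ a₁' : ℝ}
    (h : HalvingStepTopCoreG F N Sup Adm B₃ a₀ a₁) (ha₀ : a₀' ≤ a₀) (ha₁ : a₁' ≤ a₁) : HalvingStepTopCoreG F N Sup Adm B₃ a₀' a₁' :=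
  fun ν M g K k s hsep hM₁ hadm hk ε δ hδ hcomp hcomp' hε hεcomp hεcomp' W h7 U h17 h19 hfib hcrit =>
    h ν M g K k s hsep hM₁ hadm hk ε δ (fun n hn => ⟨(hδ n hn).1, (hδ n hn).2.trans ha₁⟩) hcomp hcomp'
      (fun n hn => ⟨(hε n hn).1, (hε n hn).2.trans ha₀⟩) hεcomp hεcomp' W h7 U h17 h19 hfib hcrit

/-- Antitone in the guard (core form). [cite: Balaban1985Variational, Sect. F p.304 (bookkeeping)] -/
theorem HalvingStepTopCoreG.of_imp {Sup : (ν : Stage7Numerics) → (K : ℕ) → (ℕ → Set (Site (F.P K) 0)) → Set (Site (F.P K) 0)} {Adm Adm' : StepGuard F} {B₃ a₀ a₁ : ℝ}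
    (h : HalvingStepTopCoreG F N Sup Adm B₃ a₀ a₁) (himp : ∀ ν M g K k s, Adm' ν M g K k s → Adm ν M g K k s) :
    HalvingStepTopCoreG F N Sup Adm' B₃ a₀ a₁ :=
  fun ν M g K k s hsep hM₁ hadm' hk => h ν M g K k s hsep hM₁ (himp ν M g K k s hadm') hk

/-- With the trivial guard the guarded core fact IS the floor-free one. [cite: Balaban1985Variational, Sect. F p.304 (bookkeeping)] -/
theorem halvingStepTopCoreG_top_iff {Sup : (ν : Stage7Numerics) → (K : ℕ) → (ℕ → Set (Site (F.P K) 0)) → Set (Site (F.P K) 0)} {B₃ a₀ a₁ : ℝ} :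
    HalvingStepTopCoreG F N Sup (fun _ _ _ _ _ _ => True) B₃ a₀ a₁ ↔ HalvingStepTopCore F N Sup B₃ a₀ a₁ :=
  ⟨fun h ν M g K k s hsep hM₁ hk => h ν M g K k s hsep hM₁ trivial hk, fun h => h.toG _⟩

/-- Module 46's floor edition IS the instance `Adm := floorGuard F c` (core form). [cite: Balaban1985RegularSpaces, (1.3)–(1.6) p.77 (bookkeeping)] -/
theorem halvingStepTopCoreR_iff_G_floorGuard {Sup : (ν : Stage7Numerics) → (K : ℕ) → (ℕ → Set (Site (F.P K) 0)) → Set (Site (F.P K) 0)} {c : ℕ} {B₃ a₀ a₁ : ℝ} :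
    HalvingStepTopCoreR F N Sup c B₃ a₀ a₁ ↔ HalvingStepTopCoreG F N Sup (floorGuard F c) B₃ a₀ a₁ :=
  Iff.rfl

/-- A floor-carrying core fact serves every guard implying its floor. [cite: Balaban1985RegularSpaces, (1.3)–(1.6) p.77 (bookkeeping)] -/
theorem HalvingStepTopCoreR.toG_of_imp_floor {Sup : (ν : Stage7Numerics) → (K : ℕ) → (ℕ → Set (Site (F.P K) 0)) → Set (Site (F.P K) 0)} {c : ℕ} {Adm : StepGuard F}
    {B₃ a₀ a₁ : ℝ} (h : HalvingStepTopCoreR F N Sup c B₃ a₀ a₁) (himp : ∀ ν M g K k s, Adm ν M g K k s → c ≤ ν.M₁) :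
    HalvingStepTopCoreG F N Sup Adm B₃ a₀ a₁ :=
  (halvingStepTopCoreR_iff_G_floorGuard.1 h).of_imp himp

/-- A guarded core fact whose guard follows from a floor is floor-carrying. [cite: Balaban1985RegularSpaces, (1.3)–(1.6) p.77 (bookkeeping)] -/
theorem HalvingStepTopCoreG.toR_of_floor_imp {Sup : (ν : Stage7Numerics) → (K : ℕ) → (ℕ → Set (Site (F.P K) 0)) → Set (Site (F.P K) 0)} {c : ℕ} {Adm : StepGuard F}
    {B₃ a₀ a₁ : ℝ} (h : HalvingStepTopCoreG F N Sup Adm B₃ a₀ a₁) (himp : ∀ ν M g K k s, c ≤ ν.M₁ → Adm ν M g K k s) :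
    HalvingStepTopCoreR F N Sup c B₃ a₀ a₁ :=
  halvingStepTopCoreR_iff_G_floorGuard.2 (h.of_imp himp)

/-- ★ RESTRICTION with the guard: the full one-step fact implies its core form, guard unchanged. [cite: Balaban1985Variational, Sect. F p.304 (bookkeeping)] -/
theorem halvingStepTopCoreG_of_halvingStepTopG {Sup : (ν : Stage7Numerics) → (K : ℕ) → (ℕ → Set (Site (F.P K) 0)) → Set (Site (F.P K) 0)}
    {Adm : StepGuard F} {B₃ a₀ a₁ : ℝ} (h : HalvingStepTopG F N Sup Adm B₃ a₀ a₁) : HalvingStepTopCoreG F N Sup Adm B₃ a₀ a₁ := by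
  intro ν M g K k s hsep hM₁ hadm hk ε δ hδ hcomp hcomp' hε hεcomp hεcomp' W h7 U h17 h19 hfib hcrit
  obtain ⟨hP, hD⟩ := h ν M g K k s hsep hM₁ hadm hk ε δ hδ hcomp hcomp' hε hεcomp hεcomp' W h7 U h17 h19 hfib hcrit
  exact ⟨fun n hn p hp _ => hP n hn p hp, fun n hn b hb _ => hD n hn b hb⟩

end FactsG

/-! ## §2  Module 30's iteration and equivalence WITH an arbitrary guard -/

section IterationG

variable {F : T4Family} {N : ℕ} [NeZero N]

/-- ★ «We continue this way», guard-generic: module 30's `classTop_iterate_of_halvingStepTop` with `(hadm : Adm ν M g K k s)` threaded. [cite: Balaban1985Variational, p.304 before Prop. 8] -/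
theorem classTop_iterate_of_halvingStepTopG {Sup : (ν : Stage7Numerics) → (K : ℕ) → (ℕ → Set (Site (F.P K) 0)) → Set (Site (F.P K) 0)}
    {B₃ a₀ a₁ : ℝ} (hB₃ : 0 ≤ B₃) {Adm : StepGuard F} (h : HalvingStepTopG F N Sup Adm B₃ a₀ a₁) (ν : Stage7Numerics) (M : ℕ) (g : ℕ → ℝ) (K k : ℕ)
    (s : SeqOfRecord F ν M g K k) (hsep : Sect2.SeqSeparated ν.M₁ s) (hM₁ : 0 < ν.M₁) (hadm : Adm ν M g K k s) (hk : 1 ≤ k) (ε₀ : ℝ) (δ : ℕ → ℝ)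
    (hδ : ∀ n, n ≤ k → 0 < δ n ∧ δ n ≤ a₁ ∧ B₃ * δ n ≤ ε₀) (hcomp : ∀ n, n < k → δ n ≤ 2 * δ (n + 1))
    (hcomp' : ∀ n, n < k → δ (n + 1) ≤ 2 * δ n) (hε₀ : ε₀ ≤ a₀) (W : MSField (F.P K) (SU N))
    (h7 : Sect2.DataSmall7PTop (avOfRecord F N K) s.Ω (Sup ν K s.Ω) k δ W) (U : GaugeField (F.P K) 0 (SU N))
    (h17 : ∀ n, n ≤ k → PlaqSmallOn (Sect2.omegaPlaqsTop s.Ω (Sup ν K s.Ω) n) (ε₀ * (F.P K).eta n ^ 2) U)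
    (h19 : Sect2.CoDivClassOnTop s.Ω (Sup ν K s.Ω) k ε₀ U) (hfib : AgreeOn (genSet s.Ω k) (avgFamily (avOfRecord F N K) U) W)
    (hcrit : IsCritOnFibre F N K (genSet s.Ω k) W U) (m : ℕ) :
    (∀ n, n ≤ k → PlaqSmallOn (Sect2.omegaPlaqsTop s.Ω (Sup ν K s.Ω) n) (max (B₃ * δ n) (ε₀ / 2 ^ m) * (F.P K).eta n ^ 2) U) ∧
      ∀ n, n ≤ k → Sect2.CoDivSmallOn (Sect2.omegaBondsTop s.Ω (Sup ν K s.Ω) n) (max (B₃ * δ n) (ε₀ / 2 ^ m) * (F.P K).eta n ^ 3) U := by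
  have hη : ∀ n, 0 ≤ (F.P K).eta n := eta_nonneg_g (F.P K)
  -- `0 ≤ B₃δ_0 ≤ ε₀`: the starting radius is non-negative
  have hε₀nn : 0 ≤ ε₀ := (mul_nonneg hB₃ (hδ 0 (Nat.zero_le _)).1.le).trans (hδ 0 (Nat.zero_le _)).2.2
  induction m with
  | zero =>
    -- the weakening `ε₀ ≤ max{B₃δ_n, ε₀}`
    have hle : ∀ n, ε₀ ≤ max (B₃ * δ n) (ε₀ / 2 ^ 0) := fun n => by
      rw [pow_zero, div_one]
      exact le_max_right _ _
    exact ⟨fun n hn => plaqSmallOn_of_le_g (h17 n hn) (mul_le_mul_of_nonneg_right (hle n) (pow_nonneg (hη n) 2)),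
      fun n hn => (h19 n hn).of_le (mul_le_mul_of_nonneg_right (hle n) (pow_nonneg (hη n) 3))⟩
  | succ m ih =>
    -- «we apply again the whole reasoning with ½ε₀ instead of ε₀», at the radii `ε_n := max{B₃δ_n, ε₀/2^m}`
    have hc : 0 ≤ ε₀ / 2 ^ m := div_nonneg hε₀nn (pow_nonneg zero_le_two m)
    have hεblk : ∀ n, n ≤ k → B₃ * δ n ≤ max (B₃ * δ n) (ε₀ / 2 ^ m) ∧ max (B₃ * δ n) (ε₀ / 2 ^ m) ≤ a₀ := fun n hn =>
      ⟨le_max_left _ _, (B11Prop8Assembly.stage_le (hδ n hn).2.2 hε₀nn m).trans hε₀⟩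
    have hεcomp : ∀ n, n < k → max (B₃ * δ n) (ε₀ / 2 ^ m) ≤ 2 * max (B₃ * δ (n + 1)) (ε₀ / 2 ^ m) := fun n hn =>
      max_le_two_mul_max_g hB₃ hc (hcomp n hn)
    have hεcomp' : ∀ n, n < k → max (B₃ * δ (n + 1)) (ε₀ / 2 ^ m) ≤ 2 * max (B₃ * δ n) (ε₀ / 2 ^ m) := fun n hn =>
      max_le_two_mul_max_g hB₃ hc (hcomp' n hn)
    obtain ⟨hP, hD⟩ := h ν M g K k s hsep hM₁ hadm hk (fun n => max (B₃ * δ n) (ε₀ / 2 ^ m)) δ (fun n hn => ⟨(hδ n hn).1, (hδ n hn).2.1⟩) hcomp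
      hcomp' hεblk hεcomp hεcomp' W h7 U ih.1 ih.2 hfib hcrit
    -- the output radius `max{B₃δ_n, ½·max{B₃δ_n, ε₀/2^m}} ≤ max{B₃δ_n, ε₀/2^{m+1}}`
    have hhalf : ∀ n, n ≤ k → max (B₃ * δ n) (max (B₃ * δ n) (ε₀ / 2 ^ m) / 2) ≤ max (B₃ * δ n) (ε₀ / 2 ^ (m + 1)) := fun n hn =>
      B11Prop8Assembly.max_half_le (mul_nonneg hB₃ (hδ n hn).1.le) m
    exact ⟨fun n hn => plaqSmallOn_of_le_g (hP n hn) (mul_le_mul_of_nonneg_right (hhalf n hn) (pow_nonneg (hη n) 2)),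
      fun n hn => (hD n hn).of_le (mul_le_mul_of_nonneg_right (hhalf n hn) (pow_nonneg (hη n) 3))⟩

end IterationG

section Prop8FromHalvingG

variable {F : T4Family} {N : ℕ} [NeZero N]

/-- ★★ **PROPOSITION 8's TOP STEP FROM SECT. F's ONE-STEP IMPROVEMENT, UNDER ANY GUARD** («until we reach the bound B₃ε₁»): `HalvingStepTopG Adm ⇒ Prop8RegSepTopStepG Adm`
(`0 < B₃`), same constants, same guard. [cite: Balaban1985Variational, Prop. 8 p.304, Sect. F pp.300–304] -/
theorem prop8RegSepTopStepG_of_halvingStepTopG {Sup : (ν : Stage7Numerics) → (K : ℕ) → (ℕ → Set (Site (F.P K) 0)) → Set (Site (F.P K) 0)}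
    {B₃ a₀ a₁ : ℝ} (hB₃ : 0 < B₃) {Adm : StepGuard F} (h : HalvingStepTopG F N Sup Adm B₃ a₀ a₁) : Prop8RegSepTopStepG F N Sup Adm B₃ a₀ a₁ := by
  intro ν M g K k s hsep hM₁ hadm hk ε₀ δ hδ hcomp hcomp' hε₀ W h7 U h17 h19 hfib hcrit
  have hit := classTop_iterate_of_halvingStepTopG hB₃.le h ν M g K k s hsep hM₁ hadm hk ε₀ δ hδ hcomp hcomp' hε₀ W h7 U h17 h19 hfib hcrit
  refine ⟨fun n hn => ?_, fun n hn => ?_⟩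
  · obtain ⟨m, hm⟩ := B11.halving_reaches_B3eps1 ε₀ (B₃ * δ n) (mul_pos hB₃ (hδ n hn).1)
    have hP := (hit m).1 n hn
    rwa [hm] at hP
  · obtain ⟨m, hm⟩ := B11.halving_reaches_B3eps1 ε₀ (B₃ * δ n) (mul_pos hB₃ (hδ n hn).1)
    have hD := (hit m).2 n hn
    rwa [hm] at hD

/-- ★ The converse under any guard: `Prop8RegSepTopStepG Adm ⇒ HalvingStepTopG Adm` (one application at the scalar radius `a₀`). [cite: Balaban1985Variational, Prop. 8 p.304 (bookkeeping)] -/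
theorem halvingStepTopG_of_prop8RegSepTopStepG {Sup : (ν : Stage7Numerics) → (K : ℕ) → (ℕ → Set (Site (F.P K) 0)) → Set (Site (F.P K) 0)}
    {B₃ a₀ a₁ : ℝ} {Adm : StepGuard F} (h : Prop8RegSepTopStepG F N Sup Adm B₃ a₀ a₁) : HalvingStepTopG F N Sup Adm B₃ a₀ a₁ := by
  intro ν M g K k s hsep hM₁ hadm hk ε δ hδ hcomp hcomp' hε _hεcomp _hεcomp' W h7 U h17 h19 hfib hcrit
  have hη : ∀ n, 0 ≤ (F.P K).eta n := eta_nonneg_g (F.P K)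
  -- the class at radii `ε_n ≤ a₀` lies in the class at the scalar radius `a₀`
  have h17' : ∀ n, n ≤ k → PlaqSmallOn (Sect2.omegaPlaqsTop s.Ω (Sup ν K s.Ω) n) (a₀ * (F.P K).eta n ^ 2) U := fun n hn =>
    plaqSmallOn_of_le_g (h17 n hn) (mul_le_mul_of_nonneg_right (hε n hn).2 (pow_nonneg (hη n) 2))
  have h19' : Sect2.CoDivClassOnTop s.Ω (Sup ν K s.Ω) k a₀ U := fun n hn =>
    (h19 n hn).of_le (mul_le_mul_of_nonneg_right (hε n hn).2 (pow_nonneg (hη n) 3))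
  obtain ⟨hP, hD⟩ := h ν M g K k s hsep hM₁ hadm hk a₀ δ (fun n hn => ⟨(hδ n hn).1, (hδ n hn).2, (hε n hn).1.trans (hε n hn).2⟩)
    hcomp hcomp' le_rfl W h7 U h17' h19' hfib hcrit
  exact ⟨fun n hn => plaqSmallOn_of_le_g (hP n hn) (mul_le_mul_of_nonneg_right (le_max_left _ _) (pow_nonneg (hη n) 2)),
    fun n hn => (hD n hn).of_le (mul_le_mul_of_nonneg_right (le_max_left _ _) (pow_nonneg (hη n) 3))⟩

/-- ★★ **EQUIVALENCE UNDER ANY GUARD** (`0 < B₃`): `HalvingStepTopG Adm ⟺ Prop8RegSepTopStepG Adm`. [cite: Balaban1985Variational, Prop. 8 p.304, Sect. F pp.300–304 (bookkeeping)] -/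
theorem halvingStepTopG_iff_prop8RegSepTopStepG {Sup : (ν : Stage7Numerics) → (K : ℕ) → (ℕ → Set (Site (F.P K) 0)) → Set (Site (F.P K) 0)}
    {Adm : StepGuard F} {B₃ a₀ a₁ : ℝ} (hB₃ : 0 < B₃) : HalvingStepTopG F N Sup Adm B₃ a₀ a₁ ↔ Prop8RegSepTopStepG F N Sup Adm B₃ a₀ a₁ :=
  ⟨prop8RegSepTopStepG_of_halvingStepTopG hB₃, halvingStepTopG_of_prop8RegSepTopStepG⟩

/-- ★ THE WHOLE GUARDED CHAIN IN ONE LINE: a guarded core-to-top link (k0-s1-w3's direction, taken as a hypothesis at the SAME guard) and the guarded one-step fact's core form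
give Proposition 8's guarded top step. [cite: Balaban1985Variational, Prop. 8 p.304, Sect. F pp.300–304 (bookkeeping)] -/
theorem prop8RegSepTopStepG_of_coreG_of_link {Sup : (ν : Stage7Numerics) → (K : ℕ) → (ℕ → Set (Site (F.P K) 0)) → Set (Site (F.P K) 0)}
    {Adm : StepGuard F} {B₃ a₀ a₁ : ℝ} (hB₃ : 0 < B₃)
    (hlink : HalvingStepTopCoreG F N Sup Adm B₃ a₀ a₁ → HalvingStepTopG F N Sup Adm B₃ a₀ a₁) (hcore : HalvingStepTopCoreG F N Sup Adm B₃ a₀ a₁) :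
    Prop8RegSepTopStepG F N Sup Adm B₃ a₀ a₁ :=
  prop8RegSepTopStepG_of_halvingStepTopG hB₃ (hlink hcore)

end Prop8FromHalvingG

end Literature.MathematicalPhysics.QuantumFieldTheory.Balaban1983to89.Node00
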